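import Literature.Claims.NS.Bachani2026
import HarnessLib

/-!
# C147 `Bachani2026` — salvage: Lemma 5.1 stage (6) «rank-1 ⇒ A → √(2/3)» is TRUE (`Step_L51s6`)

Skeleton `Literature.Claims.NS.Bachani2026` (ns-claims-typist-7 g6, p524664). The typed face
`Step_L51s6` of Lemma 5.1, stage (6) (printed p.6 l.17 / l.27–28: «Directional collapse means
M → rank-1, hence A → √(2/3)») reads: for a sequence of symmetric, positive-semidefinite, trace-one
`3 × 3` matrices `Mₙ` whose top Rayleigh quotient `λ₁(Mₙ) = sup_{|v|=1} vᵀMₙv` tends to `1`, the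
anisotropy `A(Mₙ) = ‖Mₙ − I/3‖_F` tends to `√(2/3)`. This is linear algebra and is PROVED here
without spectral theory:

* `frob_le_one` — for symmetric PSD `M` with `tr M = 1`, `∑ᵢⱼ Mᵢⱼ² ≤ 1` (the 2 × 2 principal minors
  are nonnegative: `Mᵢⱼ² ≤ Mᵢᵢ Mⱼⱼ`, by the discriminant of `t ↦ q(eᵢ + t eⱼ) ≥ 0`, then
  `∑ᵢⱼ MᵢᵢMⱼⱼ = (tr M)²`);
* `qform_le_sqrt_frob` — for a unit vector, `vᵀMv ≤ (∑ᵢⱼ Mᵢⱼ²)^{1/2}` (Cauchy–Schwarz), hence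
  `λ₁(M) ≤ (∑ᵢⱼ Mᵢⱼ²)^{1/2} ≤ 1`;
* `anis_sq` — `A(M)² = ∑ᵢⱼ Mᵢⱼ² − 1/3` when `tr M = 1`;
* `step_L51s6_holds : Step_L51s6` — squeeze: `λ₁(Mₙ) ≤ ‖Mₙ‖_F ≤ 1` and `λ₁(Mₙ) → 1` force
  `‖Mₙ‖_F → 1`, so `A(Mₙ) = √(‖Mₙ‖²_F − 1/3) → √(2/3)`.

Records-grade (per-step table; the row's locator is the refuter's). ns-claims-salvage-p2 g5,
2026-08-27.

WHAT THIS IS NOT: not a claim about NS regularity or blow-up; not a claim about any author beyond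
the typed locator.
-/

noncomputable section

open Set Function Filter Topology Finset
open scoped Topology BigOperators

namespace Summit.NavierStokesRegularity.NavierStokesRegularity.Theorems.Bachani2026Salvage

open Literature.Claims.NS.Bachani2026

/-- The Frobenius square `∑ᵢⱼ Mᵢⱼ²` (plumbing abbreviation used only inside proofs).
[cite: Bachani2026, Cor 4.2 p.5 l.11] -/
theorem frob_nonneg (M : Matrix (Fin 3) (Fin 3) ℝ) : 0 ≤ ∑ i, ∑ j, M i j ^ 2 :=
  sum_nonneg fun _ _ => sum_nonneg fun _ _ => sq_nonneg _

/-- The quadratic form on `eᵢ + t eⱼ` (`i ≠ j`), for a symmetric matrix: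
`q(eᵢ + t eⱼ) = Mᵢᵢ + 2t Mᵢⱼ + t² Mⱼⱼ`. [cite: Bachani2026, Lemma 4.1 p.5 l.4–7] -/
theorem qform_single_add (M : Matrix (Fin 3) (Fin 3) ℝ) (hM : M.IsSymm) (i j : Fin 3) (hij : i ≠ j)
    (t : ℝ) :
    qform M (EuclideanSpace.single i 1 + t • EuclideanSpace.single j 1) =
      M j j * (t * t) + 2 * M i j * t + M i i := by
  have hs : ∀ a b, M a b = M b a := fun a b => by
    simpa using congrFun (congrFun hM b) a
  fin_cases i <;> fin_cases j <;> first
    | exact absurd rfl hij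
    | (simp [qform, Fin.sum_univ_three, hs 1 0, hs 2 0, hs 2 1]; ring)

/-- **Nonnegative 2 × 2 principal minors**: for symmetric PSD `M`, `Mᵢⱼ² ≤ Mᵢᵢ Mⱼⱼ`.
[cite: Bachani2026, Lemma 4.1 p.5 l.4–7] -/
theorem sq_le_diag_mul_diag (M : Matrix (Fin 3) (Fin 3) ℝ) (hM : M.IsSymm)
    (hpsd : ∀ v : E3, 0 ≤ qform M v) (i j : Fin 3) : M i j ^ 2 ≤ M i i * M j j := by
  by_cases hij : i = j
  · subst hij; rw [sq]
  · have hquad : ∀ t : ℝ, 0 ≤ M j j * (t * t) + 2 * M i j * t + M i i := fun t => by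
      rw [← qform_single_add M hM i j hij t]; exact hpsd _
    have hd := discrim_le_zero hquad
    rw [discrim] at hd
    nlinarith [hd]

/-- **`∑ᵢⱼ Mᵢⱼ² ≤ 1`** for symmetric PSD `M` with `tr M = 1` (`∑ᵢⱼ Mᵢⱼ² ≤ ∑ᵢⱼ MᵢᵢMⱼⱼ = (tr M)²`).
[cite: Bachani2026, Lemma 5.1 (6) p.6 l.17] -/
theorem frob_le_one (M : Matrix (Fin 3) (Fin 3) ℝ) (hM : M.IsSymm) (hpsd : ∀ v : E3, 0 ≤ qform M v)
    (htr : Matrix.trace M = 1) : ∑ i, ∑ j, M i j ^ 2 ≤ 1 := by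
  have h1 : ∑ i, ∑ j, M i j ^ 2 ≤ ∑ i, ∑ j, M i i * M j j :=
    sum_le_sum fun i _ => sum_le_sum fun j _ => sq_le_diag_mul_diag M hM hpsd i j
  have h2 : ∑ i : Fin 3, ∑ j : Fin 3, M i i * M j j = (∑ i : Fin 3, M i i) ^ 2 := by
    rw [sq, sum_mul_sum]
  have h3 : ∑ i : Fin 3, M i i = 1 := by
    rw [Matrix.trace] at htr; simpa [Matrix.diag] using htr
  calc ∑ i, ∑ j, M i j ^ 2 ≤ ∑ i, ∑ j, M i i * M j j := h1
    _ = 1 := by rw [h2, h3, one_pow]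

/-- **Cauchy–Schwarz for the Rayleigh quotient**: for a unit vector `v`,
`vᵀMv ≤ (∑ᵢⱼ Mᵢⱼ²)^{1/2}`. [cite: Bachani2026, Lemma 4.1 p.5 l.7] -/
theorem qform_le_sqrt_frob (M : Matrix (Fin 3) (Fin 3) ℝ) (v : E3) (hv : ‖v‖ = 1) :
    qform M v ≤ Real.sqrt (∑ i, ∑ j, M i j ^ 2) := by
  -- rewrite the double sums over the product index set
  have hq : qform M v = ∑ p : Fin 3 × Fin 3, M p.1 p.2 * (v p.1 * v p.2) := by
    rw [qform, ← Finset.sum_product']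
    · simp only [Finset.univ_product_univ]
      refine sum_congr rfl fun p _ => by ring
  have hF : ∑ i, ∑ j, M i j ^ 2 = ∑ p : Fin 3 × Fin 3, M p.1 p.2 ^ 2 := by
    rw [← Finset.sum_product']; simp only [Finset.univ_product_univ]
  have hv2 : ∑ i : Fin 3, v i ^ 2 = 1 := by
    have h := EuclideanSpace.norm_eq v
    rw [hv] at h
    have h' : ∑ i : Fin 3, ‖v i‖ ^ 2 = 1 := by
      have := congrArg (fun s : ℝ => s ^ 2) h
      simp only [one_pow] at this
      rw [Real.sq_sqrt (sum_nonneg fun _ _ => sq_nonneg _)] at this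
      exact this.symm
    simpa [Real.norm_eq_abs, sq_abs] using h'
  have hG : ∑ p : Fin 3 × Fin 3, (v p.1 * v p.2) ^ 2 = 1 := by
    have : ∑ p : Fin 3 × Fin 3, (v p.1 * v p.2) ^ 2 =
        ∑ i : Fin 3, ∑ j : Fin 3, (v i * v j) ^ 2 := by
      rw [← Finset.sum_product']; simp only [Finset.univ_product_univ]
    rw [this]
    have : ∑ i : Fin 3, ∑ j : Fin 3, (v i * v j) ^ 2 = (∑ i : Fin 3, v i ^ 2) * ∑ j : Fin 3, v j ^ 2 := by
      rw [sum_mul_sum]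
      refine sum_congr rfl fun i _ => sum_congr rfl fun j _ => by ring
    rw [this, hv2, one_mul]
  have hCS := Finset.sum_mul_sq_le_sq_mul_sq Finset.univ
    (fun p : Fin 3 × Fin 3 => M p.1 p.2) (fun p => v p.1 * v p.2)
  rw [hG, mul_one] at hCS
  rw [hq, hF]
  exact Real.le_sqrt_of_sq_le hCS

/-- A unit vector (the north pole) — the sphere is nonempty (plumbing). [folklore] -/
private theorem sphere_nonempty : Nonempty S2 :=
  ⟨⟨EuclideanSpace.single 2 1, by simp⟩⟩

/-- **`λ₁(M) ≤ (∑ᵢⱼ Mᵢⱼ²)^{1/2}`** (sup of the Rayleigh quotient over unit vectors).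
[cite: Bachani2026, Lemma 4.1 p.5 l.7] -/
theorem lam1_le_sqrt_frob (M : Matrix (Fin 3) (Fin 3) ℝ) :
    lam1 M ≤ Real.sqrt (∑ i, ∑ j, M i j ^ 2) := by
  haveI := sphere_nonempty
  exact ciSup_le fun v => qform_le_sqrt_frob M v (mem_sphere_zero_iff_norm.1 v.2)

/-- **`A(M)² = ∑ᵢⱼ Mᵢⱼ² − 1/3`** when `tr M = 1` (the deviator's Frobenius square).
[cite: Bachani2026, Cor 4.2 p.5 l.11] -/
theorem anis_sq_arg (M : Matrix (Fin 3) (Fin 3) ℝ) (htr : Matrix.trace M = 1) :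
    ∑ i, ∑ j, (M i j - (if i = j then (1 / 3 : ℝ) else 0)) ^ 2 = ∑ i, ∑ j, M i j ^ 2 - 1 / 3 := by
  have h3 : M 0 0 + M 1 1 + M 2 2 = 1 := by
    rw [Matrix.trace] at htr; simpa [Matrix.diag, Fin.sum_univ_three] using htr
  simp only [Fin.sum_univ_three, Fin.isValue]
  simp
  nlinarith [h3]

/-- **`Step_L51s6` HOLDS** (Lemma 5.1, stage (6), printed p.6 l.17 / l.27–28 «Directional collapse
means M → rank-1, hence A → √(2/3)»): symmetric PSD trace-one `Mₙ` with `λ₁(Mₙ) → 1` have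
`A(Mₙ) → √(2/3)` — squeeze `λ₁ ≤ ‖M‖_F ≤ 1`, then `A = √(‖M‖_F² − 1/3)`.
[cite: Bachani2026, Lemma 5.1 (6) p.6 l.17, l.27–28] -/
theorem step_L51s6_holds : Step_L51s6 := by
  intro M hM hlam
  -- `F n = ∑ᵢⱼ (Mₙ)ᵢⱼ²`
  set F : ℕ → ℝ := fun n => ∑ i, ∑ j, M n i j ^ 2 with hF
  have hFle : ∀ n, F n ≤ 1 := fun n => frob_le_one (M n) (hM n).1 (hM n).2.1 (hM n).2.2
  have hF0 : ∀ n, 0 ≤ F n := fun n => frob_nonneg (M n)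
  -- squeeze: `λ₁(Mₙ) ≤ √(F n) ≤ 1`
  have hsqrt : Tendsto (fun n => Real.sqrt (F n)) atTop (𝓝 1) := by
    refine tendsto_of_tendsto_of_tendsto_of_le_of_le hlam tendsto_const_nhds
      (fun n => lam1_le_sqrt_frob (M n)) fun n => ?_
    calc Real.sqrt (F n) ≤ Real.sqrt 1 := Real.sqrt_le_sqrt (hFle n)
      _ = 1 := Real.sqrt_one
  have hFt : Tendsto F atTop (𝓝 1) := by
    have h := hsqrt.pow 2
    simp only [one_pow] at h
    refine h.congr fun n => ?_
    exact Real.sq_sqrt (hF0 n)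
  -- `A(Mₙ) = √(F n − 1/3) → √(2/3)`
  have hA : ∀ n, anis (M n) = Real.sqrt (F n - 1 / 3) := fun n => by
    rw [anis, anis_sq_arg (M n) (hM n).2.2]
  have hlim : Tendsto (fun n => Real.sqrt (F n - 1 / 3)) atTop (𝓝 (Real.sqrt (2 / 3))) := by
    have : Tendsto (fun n => F n - 1 / 3) atTop (𝓝 (1 - 1 / 3)) := hFt.sub_const _
    rw [show (1 : ℝ) - 1 / 3 = 2 / 3 by norm_num] at this
    exact this.sqrt
  simpa [hA] using hlim

/-- Type-exact probe. [cite: Bachani2026, Lemma 5.1 (6) p.6 l.17] -/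
example : Literature.Claims.NS.Bachani2026.Step_L51s6 := step_L51s6_holds

end Summit.NavierStokesRegularity.NavierStokesRegularity.Theorems.Bachani2026Salvage
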